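import Summits.CriticalPhenomena.PercolationContinuityZ3.Theorems.PercNearOneGluingNoHeavyLowerTailThreePartitionJuntaAndVar
import Summits.CriticalPhenomena.PercolationContinuityZ3.Theorems.PercNearOneGluingNoHeavyLowerTailThreePartitionJunta3Comb
import Summits.CriticalPhenomena.PercolationContinuityZ3.Theorems.PercNearOneGluingNoHeavyLowerTailThreePartitionPrincipalCombPos
import HarnessLib.Audit

/-!
# `NoHeavyLowerTail` (crux stmt-CriticalPhenomena-4575), master-family hierarchy P3 (gen 38): COMB-C3 for a junta CUT BY COINS —
# `N_τ(liftQ Q 𝔘 ∩ {S : J ⊆ S}; A, B) ≥ 0` from certificates for `𝔘`; in the kernel for EVERY 3-junta `𝔘`: the class (g(p,q,r) ∧ x₁ ∧ ⋯ ∧ x_j, A, B)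

Support file (seat `prim-masterthm-p3`; `--supports stmt-CriticalPhenomena-4575`; memo
`run/shared/lean/prim/prim-masterthm/FROM-prim-masterthm-p3-g38-PDC-STRUCTURE.md` §3).  Iterating the one-coin closure `DiagCert.andVar`
(file `…ThreePartitionJuntaAndVar`) over a finite set `J` of coins disjoint from the block `Q`: with `andVars J 𝔘 = {m : J ⊆ m, m \ J ∈ 𝔘}`,
`liftQ (Q ∪ J) (andVars J 𝔘) = liftQ Q 𝔘 ∩ {S : J ⊆ S}` and certificates for `𝔘` at every twist give certificates for `andVars J 𝔘` at every
twist (`exists_diagCert_andVars`), hence **`threePartNT_liftQ_andVars_nonneg`**: `0 ≤ threePartNT τ (liftQ Q 𝔘 ∩ {S | ↑J ⊆ S}) A B` for all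
up-sets `A, B` and every `τ`.  With the kernel-checked certificate table for 3-juntas (`…ThreePartitionJunta3`): **`threePartNT_junta3_and_nonneg`**
— COMB-C3 (all twists, every finite ground type) for every triple `(𝒰, A, B)` with `𝒰 = {S : S ∩ {p,q,r} ∈ 𝔘} ∩ {S : J ⊆ S}`, i.e. ANY increasing
function of three coins AND-ed with ANY further set of coins, `A, B` ARBITRARY increasing (e.g. `(p ∨ q ∨ r) ∧ s ∧ t`, `MAJ₃(p,q,r) ∧ s`,
`((p ∨ q) ∧ r) ∧ s ∧ t ∧ u`); any slot by `threePartNT_swap12/23`; in `DeterminedBy` form **`threePartNT_determinedBy_and_nonneg`** (any up-set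
determined by ≤ 3 coordinates, AND-ed with a disjoint finite set of coins).  The class is closed under sections, so by the comb bridge
(`combCoef3_eq_threePartNT`) **`combPos_sahiE_three_junta3_and`**: Sahi's `E₃(μ_p; 1_U, 1_V, 1_W)` is comb-positive (≥ 0 under every product measure,
`sahiE_three_junta3_and_nonneg`) whenever `U = D ∩ {x : J ⊆ x}` with `D` increasing determined by ≤ 3 coordinates and `V, W` ARBITRARY increasing.
New kernel class beyond {nested, AND, OR, one OR, 3-junta}.  On paper the same closure extends the 5-junta certificate tables (gen 37) to
`f(x₁..x₅) ∧ (coins)`.  HONEST LABEL: the general conjecture (three arbitrary increasing events) stays OPEN; nothing here bears on the closed crux. [this work]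
-/

noncomputable section

open Finset
open scoped symmDiff Classical

namespace Summit.CriticalPhenomena.PercolationContinuityZ3.Theorems.ThreePartition

variable {ι : Type*} [Fintype ι]

/-! ## Conjunction with finitely many new coins -/

section AndVars

omit [Fintype ι] in
/-- `andVars J 𝔘 = {m : J ⊆ m, m \ J ∈ 𝔘}` — the junta `𝔘` AND-ed with the coins of `J`. [this work] -/
def andVars (J : Finset ι) (𝔘 : Set (Set ι)) : Set (Set ι) := {m | (↑J : Set ι) ⊆ m ∧ m \ ↑J ∈ 𝔘}

omit [Fintype ι] in
/-- No extra coin. [this work] -/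
theorem andVars_empty (𝔘 : Set (Set ι)) : andVars ∅ 𝔘 = 𝔘 := by
  ext m; simp only [andVars, Finset.coe_empty, Set.empty_subset, Set.sdiff_empty, true_and, Set.mem_setOf_eq]

omit [Fintype ι] in
/-- One more coin. [this work] -/
theorem andVar_andVars {x : ι} {J : Finset ι} (hxJ : x ∉ J) (𝔘 : Set (Set ι)) : andVar x (andVars J 𝔘) = andVars (insert x J) 𝔘 := by
  ext m
  simp only [andVar, andVars, Set.mem_setOf_eq, Finset.coe_insert, Set.insert_subset_iff]
  have e : (m \ {x}) \ ↑J = m \ insert x ↑J := by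
    ext c; simp only [Set.mem_sdiff, Set.mem_singleton_iff, Finset.mem_coe, Set.mem_insert_iff]; tauto
  rw [e]
  constructor
  · rintro ⟨hxm, hJ, hU⟩; exact ⟨⟨hxm, fun c hc => (hJ hc).1⟩, hU⟩
  · rintro ⟨⟨hxm, hJ⟩, hU⟩
    exact ⟨hxm, fun c hc => ⟨hJ hc, fun h => hxJ (by rw [Set.mem_singleton_iff.1 h] at hc; exact hc)⟩, hU⟩

omit [Fintype ι] in
/-- `andVars J 𝔘` is an up-set if `𝔘` is. [this work] -/
theorem isUpperSet_andVars (J : Finset ι) {𝔘 : Set (Set ι)} (h𝔘 : IsUpperSet 𝔘) : IsUpperSet (andVars J 𝔘) :=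
  fun _ _ hab ha => ⟨ha.1.trans hab, h𝔘 (Set.sdiff_subset_sdiff_left hab) ha.2⟩

omit [Fintype ι] in
/-- **The junta of `andVars J 𝔘` on `Q ∪ J` is the junta of `𝔘` on `Q` cut by the coins of `J`** (`J` disjoint from `Q`). [this work] -/
theorem liftQ_union_andVars {Q : Set ι} {J : Finset ι} (hJ : Disjoint (↑J : Set ι) Q) (𝔘 : Set (Set ι)) :
    liftQ (Q ∪ ↑J) (andVars J 𝔘) = liftQ Q 𝔘 ∩ {S | (↑J : Set ι) ⊆ S} := by
  ext S
  simp only [mem_liftQ, andVars, Set.mem_inter_iff, Set.mem_setOf_eq]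
  have e : (S ∩ (Q ∪ ↑J)) \ ↑J = S ∩ Q := by
    ext c; simp only [Set.mem_sdiff, Set.mem_inter_iff, Set.mem_union, Finset.mem_coe]
    constructor
    · rintro ⟨⟨hS, hQ | hJ'⟩, hn⟩
      · exact ⟨hS, hQ⟩
      · exact absurd hJ' hn
    · rintro ⟨hS, hQ⟩; exact ⟨⟨hS, Or.inl hQ⟩, fun h => Set.disjoint_left.1 hJ h hQ⟩
  rw [e]
  constructor
  · rintro ⟨hJS, hU⟩; exact ⟨hU, fun c hc => (hJS hc).1⟩
  · rintro ⟨hU, hJS⟩; exact ⟨fun c hc => ⟨hJS hc, Or.inr hc⟩, hU⟩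

/-- **Certificates survive conjunction with finitely many new coins** (every twist). [this work] -/
theorem exists_diagCert_andVars {Q : Set ι} {𝔘 : Set (Set ι)} (h𝔘 : IsUpperSet 𝔘)
    (hcs : ∀ τ₀ : Set ι, ∃ κ : Set ι → ℤ, DiagCert τ₀ Q 𝔘 κ) (J : Finset ι) (hJ : Disjoint (↑J : Set ι) Q) (τ : Set ι) :
    ∃ κ : Set ι → ℤ, DiagCert τ (Q ∪ ↑J) (andVars J 𝔘) κ := by
  induction J using Finset.induction_on generalizing τ with
  | empty => rw [Finset.coe_empty, Set.union_empty, andVars_empty]; exact hcs τ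
  | @insert x J hxJ ih =>
    rw [Finset.coe_insert, Set.disjoint_insert_left] at hJ
    obtain ⟨κ, hκ⟩ := ih hJ.2 τ
    have hx : x ∉ Q ∪ ↑J := fun h => h.elim hJ.1 fun h' => hxJ (Finset.mem_coe.1 h')
    refine ⟨andKappa τ x κ, ?_⟩
    rw [Finset.coe_insert, ← andVar_andVars hxJ, show Q ∪ insert x (↑J : Set ι) = insert x (Q ∪ ↑J) by
      rw [Set.union_insert]]
    exact hκ.andVar (isUpperSet_andVars J h𝔘) hx

/-- **COMB-C3 for a junta cut by coins**: certificates for `𝔘` at every twist of the block give, for every finite set `J` of further coins,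
`N_τ(liftQ Q 𝔘 ∩ {S : J ⊆ S}; A, B) ≥ 0` for all up-sets `A, B` and every twist `τ`. [this work] -/
theorem threePartNT_liftQ_andVars_nonneg {Q : Set ι} {𝔘 : Set (Set ι)} (h𝔘 : IsUpperSet 𝔘)
    (hcs : ∀ τ₀ : Set ι, ∃ κ : Set ι → ℤ, DiagCert τ₀ Q 𝔘 κ) {J : Finset ι} (hJ : Disjoint (↑J : Set ι) Q)
    (τ : Set ι) {A B : Set (Set ι)} (hA : IsUpperSet A) (hB : IsUpperSet B) :
    0 ≤ threePartNT τ (liftQ Q 𝔘 ∩ {S | (↑J : Set ι) ⊆ S}) A B := by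
  rw [← liftQ_union_andVars hJ]
  obtain ⟨κ, hκ⟩ := exists_diagCert_andVars h𝔘 hcs J hJ τ
  exact threePartNT_liftQ_nonneg_of_cert hκ hA hB

end AndVars

/-! ## In the kernel: every 3-junta AND-ed with coins -/

section Junta3

open Junta3

variable {p q r : ι} (hd : p ≠ q ∧ p ≠ r ∧ q ≠ r)

include hd in
/-- The kernel certificate table `CERT3` provides a pure diagonal certificate for EVERY up-set of `{p,q,r}`-parts at EVERY twist
(extracted from the proof of `threePartNT_junta3_nonneg`). [this work] -/
theorem exists_diagCert_junta3 {𝔘 : Set (Set ι)} (h𝔘 : IsUpperSet 𝔘) (τ : Set ι) :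
    ∃ κ : Set ι → ℤ, DiagCert τ ({p, q, r} : Set ι) 𝔘 κ := by
  obtain ⟨u, hu, hmu⟩ := exists_mask (p := p) (q := q) (r := r) 𝔘 h𝔘
  have hT := checkT_all (enc p q r τ) (enc_lt p q r τ)
  unfold checkT at hT
  rw [Bool.and_eq_true, List.all_eq_true, List.all_eq_true] at hT
  obtain ⟨hall, hcov⟩ := hT
  have hc := hcov u hu
  rw [List.any_eq_true] at hc
  obtain ⟨e, he, hte⟩ := hc
  rw [Bool.and_eq_true, beq_iff_eq, beq_iff_eq] at hte
  have hchk : checkOne e.1 e.2.1 e.2.2 = true := hall e (List.mem_filter.2 ⟨he, by rw [hte.1]; exact beq_self_eq_true _⟩)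
  rw [hte.1, hte.2] at hchk
  exact ⟨_, diagCert_of_checkOne hd τ hmu hchk⟩

include hd in
/-- **THE 3-JUNTA-AND-COINS THEOREM.** For distinct `p, q, r`, any up-set `𝔘` of `{p,q,r}`-parts, any finite set `J` of further coins,
every twist `τ` and ALL up-sets `A, B`: `0 ≤ N_τ({S : S ∩ {p,q,r} ∈ 𝔘} ∩ {S : J ⊆ S}; A, B)`. [this work] -/
theorem threePartNT_junta3_and_nonneg {𝔘 : Set (Set ι)} (h𝔘 : IsUpperSet 𝔘) {J : Finset ι} (hJ : Disjoint (↑J : Set ι) {p, q, r})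
    (τ : Set ι) {A B : Set (Set ι)} (hA : IsUpperSet A) (hB : IsUpperSet B) :
    0 ≤ threePartNT τ (liftQ ({p, q, r} : Set ι) 𝔘 ∩ {S | (↑J : Set ι) ⊆ S}) A B :=
  threePartNT_liftQ_andVars_nonneg h𝔘 (fun τ₀ => exists_diagCert_junta3 hd h𝔘 τ₀) hJ τ hA hB

include hd in
/-- Any slot: `N_τ(𝒰, 𝒱, 𝒲) ≥ 0` whenever one of the three increasing events is a 3-junta on `{p,q,r}` AND-ed with the coins of `J`. [this work] -/
theorem threePartNT_nonneg_of_junta3_and {𝔘 : Set (Set ι)} (h𝔘 : IsUpperSet 𝔘) {J : Finset ι} (hJ : Disjoint (↑J : Set ι) {p, q, r})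
    (τ : Set ι) {𝒰 𝒱 𝒲 : Set (Set ι)} (h𝒰 : IsUpperSet 𝒰) (h𝒱 : IsUpperSet 𝒱) (h𝒲 : IsUpperSet 𝒲)
    (h : 𝒰 = liftQ ({p, q, r} : Set ι) 𝔘 ∩ {S | (↑J : Set ι) ⊆ S} ∨ 𝒱 = liftQ ({p, q, r} : Set ι) 𝔘 ∩ {S | (↑J : Set ι) ⊆ S}
      ∨ 𝒲 = liftQ ({p, q, r} : Set ι) 𝔘 ∩ {S | (↑J : Set ι) ⊆ S}) :
    0 ≤ threePartNT τ 𝒰 𝒱 𝒲 := by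
  rcases h with h | h | h
  · rw [h]; exact threePartNT_junta3_and_nonneg hd h𝔘 hJ τ h𝒱 h𝒲
  · rw [threePartNT_swap12, h]; exact threePartNT_junta3_and_nonneg hd h𝔘 hJ τ h𝒰 h𝒲
  · rw [threePartNT_swap23, threePartNT_swap12, h]; exact threePartNT_junta3_and_nonneg hd h𝔘 hJ τ h𝒰 h𝒱

/-- **Example: `(p ∨ q ∨ r) ∧ ⋀J`** — a disjunction of three coins AND-ed with further coins, against two ARBITRARY increasing events. [this work] -/
theorem threePartNT_or3_and_nonneg (hd : p ≠ q ∧ p ≠ r ∧ q ≠ r) {J : Finset ι} (hJ : Disjoint (↑J : Set ι) {p, q, r})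
    (τ : Set ι) {A B : Set (Set ι)} (hA : IsUpperSet A) (hB : IsUpperSet B) :
    0 ≤ threePartNT τ ({S | (S ∩ {p, q, r}).Nonempty} ∩ {S | (↑J : Set ι) ⊆ S}) A B := by
  have h := threePartNT_junta3_and_nonneg hd (𝔘 := {m : Set ι | m.Nonempty}) (fun _ _ hab ha => ha.mono hab) hJ τ hA hB
  have e : liftQ ({p, q, r} : Set ι) {m : Set ι | m.Nonempty} = {S | (S ∩ {p, q, r}).Nonempty} := by
    ext S; simp only [mem_liftQ, Set.mem_setOf_eq]
  rwa [e] at h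

end Junta3

/-! ## `DeterminedBy` form and closure under sections -/

section Determined

variable {p q r : ι}

omit [Fintype ι] in
/-- Moving one coin into the junta: `D ∩ {t ∈ ·}` is determined by `insert t S` if `D` is determined by `S`. [this work] -/
theorem determinedBy_insert_inter {S : Finset ι} {D : Set (Set ι)} (hdet : DeterminedBy (↑S) D) (t : ι) :
    DeterminedBy (↑(insert t S) : Set ι) (D ∩ {x | t ∈ x}) := by
  intro x
  simp only [Set.mem_inter_iff, Set.mem_setOf_eq, Finset.coe_insert, Set.mem_insert_iff, true_or, and_true]
  rw [hdet x, hdet (x ∩ insert t ↑S), Set.inter_assoc, Set.inter_eq_right.2 (Set.subset_insert _ _)]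

/-- **COMB-C3 for (≤ 3-junta) ∧ (coins), `DeterminedBy` form**: `D` increasing and determined by a finset `S` with `#S ≤ 3`, `J` a finset of coins
disjoint from `S`: `N_τ(D ∩ {x : J ⊆ x}; A, B) ≥ 0` for all up-sets `A, B`, every `τ`. [this work] -/
theorem threePartNT_determinedBy_and_nonneg : ∀ (n : ℕ) (S J : Finset ι), J.card = n → S.card ≤ 3 → Disjoint S J →
    ∀ {D A B : Set (Set ι)}, IsUpperSet D → DeterminedBy (↑S) D → ∀ τ : Set ι, IsUpperSet A → IsUpperSet B →
    0 ≤ threePartNT τ (D ∩ {x | (↑J : Set ι) ⊆ x}) A B := by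
  intro n
  induction n with
  | zero =>
    intro S J hJ0 hS _ D A B hD hdet τ hA hB
    rw [Finset.card_eq_zero.1 hJ0, Finset.coe_empty]
    have e : D ∩ {x : Set ι | (∅ : Set ι) ⊆ x} = D := by ext x; simp only [Set.mem_inter_iff, Set.mem_setOf_eq, Set.empty_subset, and_true]
    rw [e]; exact threePartNT_nonneg_of_determinedBy hS hD hdet τ hA hB
  | succ n ih =>
    intro S J hJn hS hSJ D A B hD hdet τ hA hB
    by_cases h3 : S.card = 3
    · obtain ⟨p, q, r, hpq, hpr, hqr, rfl⟩ := Finset.card_eq_three.1 h3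
      have hdet' : ∀ x, x ∈ D ↔ x ∩ {p, q, r} ∈ D := fun x => by
        have := hdet x; rwa [Finset.coe_insert, Finset.coe_insert, Finset.coe_singleton] at this
      have hJ : Disjoint (↑J : Set ι) {p, q, r} := by
        rw [← Finset.coe_singleton, ← Finset.coe_insert, ← Finset.coe_insert, Finset.disjoint_coe]; exact hSJ.symm
      have h := threePartNT_junta3_and_nonneg ⟨hpq, hpr, hqr⟩ hD hJ τ hA hB
      rwa [← eq_liftQ_of_determined hdet'] at h
    · obtain ⟨t, ht⟩ : J.Nonempty := Finset.card_pos.1 (by omega)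
      have e : D ∩ {x | (↑J : Set ι) ⊆ x} = (D ∩ {x | t ∈ x}) ∩ {x | (↑(J.erase t) : Set ι) ⊆ x} := by
        ext x; simp only [Set.mem_inter_iff, Set.mem_setOf_eq, Finset.coe_erase]
        constructor
        · rintro ⟨hxD, hJx⟩; exact ⟨⟨hxD, hJx (Finset.mem_coe.2 ht)⟩, Set.sdiff_subset.trans hJx⟩
        · rintro ⟨⟨hxD, htx⟩, hJx⟩
          refine ⟨hxD, fun c hc => ?_⟩
          by_cases hct : c = t
          · rw [hct]; exact htx
          · exact hJx ⟨hc, hct⟩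
      rw [e]
      refine ih (insert t S) (J.erase t) (by rw [Finset.card_erase_of_mem ht, hJn]; rfl) ?_ ?_ (hD.inter fun _ _ hab ha => hab ha)
        (determinedBy_insert_inter hdet t) τ hA hB
      · rw [Finset.card_insert_of_notMem fun h => Finset.disjoint_left.1 hSJ h ht]; omega
      · rw [Finset.disjoint_insert_left]
        exact ⟨Finset.notMem_erase t J, Finset.disjoint_of_subset_right (Finset.erase_subset t J) hSJ⟩

end Determined

/-! ## COMB-C3 ⟹ Sahi `E₃ ≥ 0` for ((≤3)-junta ∧ coins, arbitrary, arbitrary) -/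

section Comb

open Literature.Combinatorics.Sahi2008
open SahiComb

variable {α : Type} [Fintype α]

/-- Sections of the coin event `{x : J ⊆ x}`: empty if a coin of `J` is closed at the profile, else the coin event of the active part of `J`. [this work] -/
theorem secFam_supset (j : α → ℕ) (hj : ∀ e, j e ≤ 3) (J : Finset α) :
    secFam j {x : Set α | (↑J : Set α) ⊆ x} = ∅ ∨ secFam j {x : Set α | (↑J : Set α) ⊆ x} = {T | (↑(actIn j J) : Set (Act j)) ⊆ T} := by
  by_cases h0 : ∃ e ∈ J, j e = 0
  · left
    obtain ⟨e, heJ, he0⟩ := h0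
    ext T
    simp only [secFam, Set.mem_setOf_eq, Set.mem_empty_iff_false, iff_false]
    intro hT
    have := hT (Finset.mem_coe.2 heJ)
    rw [mem_liftSet_iff_of_not (by omega)] at this
    omega
  · right
    push Not at h0
    ext T
    simp only [secFam, Set.mem_setOf_eq]
    constructor
    · intro hT e he
      have he' : e.1 ∈ J := by unfold actIn at he; exact (Finset.mem_filter.1 (Finset.mem_coe.1 he)).2
      exact (val_mem_liftSet_iff e).1 (hT (Finset.mem_coe.2 he'))
    · intro hT e he
      have heJ := Finset.mem_coe.1 he
      by_cases ha : j e = 1 ∨ j e = 2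
      · rw [mem_liftSet_iff ha]
        apply hT
        unfold actIn; rw [Finset.mem_coe, Finset.mem_filter]; exact ⟨Finset.mem_univ _, heJ⟩
      · rw [mem_liftSet_iff_of_not ha]
        have := hj e; have := h0 e heJ; omega

/-- **COMB-C3 for ((≤3)-junta ∧ coins, arbitrary, arbitrary)**: `E₃(μ_p; 1_U, 1_V, 1_W)` is a nonnegative combination of the degree-3
tensor-Bernstein basis whenever `U = D ∩ {x : J ⊆ x}`, `D` increasing and determined by a finset `S` of at most three coordinates, `J` a finset
of coins disjoint from `S`, and `V, W` arbitrary increasing events. [this work] -/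
theorem combPos_sahiE_three_junta3_and {S J : Finset α} (hS : S.card ≤ 3) (hSJ : Disjoint S J) {D V W : Set (Set α)} (hD : IsUpperSet D)
    (hdet : DeterminedBy (↑S) D) (hV : IsUpperSet V) (hW : IsUpperSet W) :
    CombPos (fun _ : α => 3) (fun p => sahiE (bernoulliWeight p) 3 ![Literature.Probability.Percolation.DecisionTree.ind (D ∩ {x | (↑J : Set α) ⊆ x}),
      Literature.Probability.Percolation.DecisionTree.ind V, Literature.Probability.Percolation.DecisionTree.ind W]) := by
  refine combPos_sahiE_three_of_combCoef3_nonneg fun j => ?_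
  by_cases hj : ∀ e, j e ≤ 3
  · rw [combCoef3_eq_threePartNT _ V W hj, secFam_inter]
    rcases secFam_supset j hj J with h0 | h1
    · rw [h0, Set.inter_empty, threePartNT_empty_left]; exact_mod_cast le_rfl
    · rw [h1]
      have hdisj : Disjoint (actIn j S) (actIn j J) := by
        rw [Finset.disjoint_left]; intro e heS heJ
        unfold actIn at heS heJ
        exact Finset.disjoint_left.1 hSJ (Finset.mem_filter.1 heS).2 (Finset.mem_filter.1 heJ).2
      exact_mod_cast threePartNT_determinedBy_and_nonneg _ (actIn j S) (actIn j J) rfl ((card_actIn_le j S).trans hS) hdisj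
        (isUpperSet_secFam j hD) (determinedBy_secFam j hdet) (twist j) (isUpperSet_secFam j hV) (isUpperSet_secFam j hW)
  · rw [combCoef3_eq_zero_of_not_le _ V W hj]

/-- **Sahi's `E₃ ≥ 0` for ((≤3)-junta ∧ coins, arbitrary, arbitrary) under every product measure.** [this work] -/
theorem sahiE_three_junta3_and_nonneg {S J : Finset α} (hS : S.card ≤ 3) (hSJ : Disjoint S J) {D V W : Set (Set α)} (hD : IsUpperSet D)
    (hdet : DeterminedBy (↑S) D) (hV : IsUpperSet V) (hW : IsUpperSet W) (p : α → unitInterval) :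
    0 ≤ sahiE (bernoulliWeight p) 3 ![Literature.Probability.Percolation.DecisionTree.ind (D ∩ {x | (↑J : Set α) ⊆ x}),
      Literature.Probability.Percolation.DecisionTree.ind V, Literature.Probability.Percolation.DecisionTree.ind W] :=
  (combPos_sahiE_three_junta3_and hS hSJ hD hdet hV hW).nonneg p

/-- **Example: `(p ∨ q ∨ r) ∧ s ∧ t`-type events.** `E₃(μ_p; 1_{OR(S) ∧ AND(J)}, 1_V, 1_W)` is comb-positive for `#S ≤ 3`, `J` disjoint from `S`,
`V, W` arbitrary increasing. [this work] -/
theorem combPos_sahiE_three_or3_and {S J : Finset α} (hS : S.card ≤ 3) (hSJ : Disjoint S J) {V W : Set (Set α)}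
    (hV : IsUpperSet V) (hW : IsUpperSet W) :
    CombPos (fun _ : α => 3) (fun p => sahiE (bernoulliWeight p) 3
      ![Literature.Probability.Percolation.DecisionTree.ind ({x : Set α | (x ∩ ↑S).Nonempty} ∩ {x | (↑J : Set α) ⊆ x}),
        Literature.Probability.Percolation.DecisionTree.ind V, Literature.Probability.Percolation.DecisionTree.ind W]) :=
  combPos_sahiE_three_junta3_and hS hSJ (fun _ _ hab ha => ha.mono (Set.inter_subset_inter_left _ hab))
    (fun x => by simp only [Set.mem_setOf_eq, Set.inter_assoc, Set.inter_self]) hV hW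

end Comb

end Summit.CriticalPhenomena.PercolationContinuityZ3.Theorems.ThreePartition


/-! ## Convenience forms (appended) -/

namespace Summit.CriticalPhenomena.PercolationContinuityZ3.Theorems.ThreePartition

variable {ι : Type*} [Fintype ι]

/-- **COMB-C3 for ((≤3)-junta) ∧ (coins)** without the auxiliary cardinality parameter. [this work] -/
theorem threePartNT_determinedBy_and_nonneg' {S J : Finset ι} (hS : S.card ≤ 3) (hSJ : Disjoint S J) {D A B : Set (Set ι)}
    (hD : IsUpperSet D) (hdet : DeterminedBy (↑S) D) (τ : Set ι) (hA : IsUpperSet A) (hB : IsUpperSet B) :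
    0 ≤ threePartNT τ (D ∩ {x | (↑J : Set ι) ⊆ x}) A B :=
  threePartNT_determinedBy_and_nonneg _ S J rfl hS hSJ hD hdet τ hA hB

/-- **Any slot**: `N_τ(𝒰, 𝒱, 𝒲) ≥ 0` whenever one of the three increasing events is `D ∩ {x : J ⊆ x}` with `D` increasing, determined by a finset `S`
of at most three coordinates, and `J` a finset disjoint from `S`. [this work] -/
theorem threePartNT_nonneg_of_determinedBy_and {S J : Finset ι} (hS : S.card ≤ 3) (hSJ : Disjoint S J) {D : Set (Set ι)}
    (hD : IsUpperSet D) (hdet : DeterminedBy (↑S) D) (τ : Set ι) {𝒰 𝒱 𝒲 : Set (Set ι)} (h𝒰 : IsUpperSet 𝒰) (h𝒱 : IsUpperSet 𝒱)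
    (h𝒲 : IsUpperSet 𝒲) (h : 𝒰 = D ∩ {x | (↑J : Set ι) ⊆ x} ∨ 𝒱 = D ∩ {x | (↑J : Set ι) ⊆ x} ∨ 𝒲 = D ∩ {x | (↑J : Set ι) ⊆ x}) :
    0 ≤ threePartNT τ 𝒰 𝒱 𝒲 := by
  rcases h with h | h | h
  · rw [h]; exact threePartNT_determinedBy_and_nonneg' hS hSJ hD hdet τ h𝒱 h𝒲
  · rw [threePartNT_swap12, h]; exact threePartNT_determinedBy_and_nonneg' hS hSJ hD hdet τ h𝒰 h𝒲
  · rw [threePartNT_swap23, threePartNT_swap12, h]; exact threePartNT_determinedBy_and_nonneg' hS hSJ hD hdet τ h𝒰 h𝒱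

end Summit.CriticalPhenomena.PercolationContinuityZ3.Theorems.ThreePartition

end
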